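import Summits.Schanuel.Schanuel.Theorems.ZilberEacDensityLift
import HarnessLib

/-!
# The graph lift `W^f(S) = {(s, x, y) : s ∈ S, x = f(x_S)}`, I: algebra

Zilber's Exponential-Algebraic Closedness, case ladder (host summit Schanuel, cell `pub-schanuel`,
seat 2, gen 6).  Companion of the density lift `W_e(S)` (`ZilberEacDensityLift`): for
`S ⊆ K^n × K^n` and a polynomial `f` in the ADDITIVE variables, the **graph lift**

  `W^f(S) = {w ∈ K^{n+1} × K^{n+1} : pr w ∈ S, x_last = f(x(pr w))}`   (`y_last` free)

raises `n` by one but NOT the dimension of the additive projection (its base is the graph of `f`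
over the base of `S`); an exponential point of `W^f(S)` is an exponential point `s` of `S` together
with `y_last = e^{f(x_s)}`, so `W^f(S)` meets `Γ_exp` iff `S` does.  With a suitable `f` (additive
freeness, `ZilberEacGraphLiftTorus`) this gives the second rung monotonicity
`ECCell (n+1) d → ECCell n d` (`ZilberEacGraphLiftRotund`), whence every cell of the open regime
implies the first open rung `ECCell 3 2`.

This file: `W^f(S) ≅ S × 𝔸¹` algebraically — the substitution
`graphHom f : K[x, x_last, y, y_last] → K[x, y][T]`, `x_last ↦ f(x)`, `y_last ↦ T`, has
`I(W^f(S)) = graphHom⁻¹ (I(S)[T])` (`vanishingIdeal_graphVar`), whence `W^f(S)` is Zariski closed,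
irreducible when `S` is, and `dim W^f(S) = dim S + 1`.  Elementary commutative algebra, parallel to
`ZilberEacDensityLift`.

HONEST FRAMING: bookkeeping towards implications between OPEN cells of EAC; `EC(3,2)` OPEN; nothing
here bears on Schanuel's conjecture (EAC ⇏ SC).
-/

noncomputable section

open MvPolynomial
open Literature.NumberTheory.Transcendental Literature.ModelTheory.Zilber

set_option linter.dupNamespace false

namespace Summit.Schanuel.Schanuel.Theorems

variable {K : Type*} [Field K] {d : ℕ}

/-! ## The graph lift: points, set, substitution -/

/-- The point of `K^{d+1} × K^{d+1}` over `s ∈ K^d × K^d` with last additive coordinate `f(x_s)` and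
last multiplicative coordinate `t`. [folklore] -/
def graphPt (f : MvPolynomial (Fin d) K) (s : Fin d ⊕ Fin d → K) (t : K) :
    Fin (d + 1) ⊕ Fin (d + 1) → K :=
  Sum.elim (Fin.snoc (fun i => s (Sum.inl i)) (MvPolynomial.eval (fun i => s (Sum.inl i)) f))
    (Fin.snoc (fun i => s (Sum.inr i)) t)

/-- **The graph lift** `W^f(S) = {w : pr w ∈ S, x_last = f(x(pr w))}` (`y_last` free). [folklore] -/
def graphVar (f : MvPolynomial (Fin d) K) (S : Set (Fin d ⊕ Fin d → K)) :
    Set (Fin (d + 1) ⊕ Fin (d + 1) → K) :=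
  {w | (fun t : Fin d ⊕ Fin d => w (Sum.map Fin.castSucc Fin.castSucc t)) ∈ S ∧
    w (Sum.inl (Fin.last d)) = MvPolynomial.eval (fun i : Fin d => w (Sum.inl (Fin.castSucc i))) f}

/-- The substitution `K[x, x_last, y, y_last] → K[x, y][T]`: `x_last ↦ f(x)`, `y_last ↦ T`, the other
variables to themselves (as constants). [folklore] -/
def graphHom (f : MvPolynomial (Fin d) K) :
    MvPolynomial (Fin (d + 1) ⊕ Fin (d + 1)) K →ₐ[K] Polynomial (MvPolynomial (Fin d ⊕ Fin d) K) :=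
  MvPolynomial.aeval
    (Sum.elim (Fin.snoc (fun i => Polynomial.C (X (Sum.inl i))) (Polynomial.C (rename Sum.inl f)))
      (Fin.snoc (fun i => Polynomial.C (X (Sum.inr i))) Polynomial.X))

variable (f : MvPolynomial (Fin d) K)

/-- Small additive coordinates of `graphPt`. [folklore] -/
@[simp] theorem graphPt_inl_castSucc (s : Fin d ⊕ Fin d → K) (t : K) (i : Fin d) :
    graphPt f s t (Sum.inl (Fin.castSucc i)) = s (Sum.inl i) := by
  simp [graphPt]

/-- Small multiplicative coordinates of `graphPt`. [folklore] -/
@[simp] theorem graphPt_inr_castSucc (s : Fin d ⊕ Fin d → K) (t : K) (i : Fin d) :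
    graphPt f s t (Sum.inr (Fin.castSucc i)) = s (Sum.inr i) := by
  simp [graphPt]

/-- Last additive coordinate of `graphPt`. [folklore] -/
@[simp] theorem graphPt_inl_last (s : Fin d ⊕ Fin d → K) (t : K) :
    graphPt f s t (Sum.inl (Fin.last d)) = MvPolynomial.eval (fun i => s (Sum.inl i)) f := by
  simp [graphPt]

/-- Last multiplicative coordinate of `graphPt`. [folklore] -/
@[simp] theorem graphPt_inr_last (s : Fin d ⊕ Fin d → K) (t : K) :
    graphPt f s t (Sum.inr (Fin.last d)) = t := by
  simp [graphPt]

/-- `pr (graphPt f s t) = s`. [folklore] -/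
theorem pr_graphPt (s : Fin d ⊕ Fin d → K) (t : K) :
    (fun u : Fin d ⊕ Fin d => graphPt f s t (Sum.map Fin.castSucc Fin.castSucc u)) = s := by
  funext u
  rcases u with i | i
  · simp
  · simp

/-- The additive projection of `graphPt f s t` is `(π s, f(π s))`. [folklore] -/
theorem projAdd_graphPt (s : Fin d ⊕ Fin d → K) (t : K) :
    projAdd (graphPt f s t) = Fin.snoc (projAdd s) (MvPolynomial.eval (projAdd s) f) := by
  funext j
  rcases Fin.eq_castSucc_or_eq_last j with ⟨i, rfl⟩ | rfl
  · rw [projAdd_apply, graphPt_inl_castSucc, Fin.snoc_castSucc, projAdd_apply]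
  · rw [projAdd_apply, graphPt_inl_last, Fin.snoc_last]
    rfl

/-- `graphPt f s t ∈ W^f(S) ↔ s ∈ S`. [folklore] -/
theorem graphPt_mem_graphVar_iff {S : Set (Fin d ⊕ Fin d → K)} (s : Fin d ⊕ Fin d → K) (t : K) :
    graphPt f s t ∈ graphVar f S ↔ s ∈ S := by
  simp only [graphVar, Set.mem_setOf_eq, graphPt_inl_last, graphPt_inl_castSucc]
  rw [pr_graphPt]
  simp

/-- Every point of `W^f(S)` is a `graphPt`. [folklore] -/
theorem eq_graphPt_of_mem {S : Set (Fin d ⊕ Fin d → K)} {w : Fin (d + 1) ⊕ Fin (d + 1) → K}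
    (hw : w ∈ graphVar f S) :
    w = graphPt f (fun t : Fin d ⊕ Fin d => w (Sum.map Fin.castSucc Fin.castSucc t))
      (w (Sum.inr (Fin.last d))) := by
  funext j
  rcases j with j | j
  · rcases Fin.eq_castSucc_or_eq_last j with ⟨i, rfl⟩ | rfl
    · rw [graphPt_inl_castSucc, Sum.map_inl]
    · rw [graphPt_inl_last]
      exact hw.2
  · rcases Fin.eq_castSucc_or_eq_last j with ⟨i, rfl⟩ | rfl
    · rw [graphPt_inr_castSucc, Sum.map_inr]
    · rw [graphPt_inr_last]

/-- Membership in `W^f(S)`: the points are exactly the `graphPt f s t`, `s ∈ S`. [folklore] -/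
theorem mem_graphVar_iff {S : Set (Fin d ⊕ Fin d → K)} {w : Fin (d + 1) ⊕ Fin (d + 1) → K} :
    w ∈ graphVar f S ↔ ∃ s ∈ S, ∃ t : K, w = graphPt f s t := by
  constructor
  · intro hw
    exact ⟨_, hw.1, _, eq_graphPt_of_mem f hw⟩
  · rintro ⟨s, hs, t, rfl⟩
    exact (graphPt_mem_graphVar_iff f s t).2 hs

/-! ## The substitution on variables -/

/-- `graphHom` on a small additive variable. [folklore] -/
@[simp] theorem graphHom_X_inl_castSucc (i : Fin d) :
    graphHom f (X (Sum.inl (Fin.castSucc i))) = Polynomial.C (X (Sum.inl i)) := by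
  simp [graphHom]

/-- `graphHom` on a small multiplicative variable. [folklore] -/
@[simp] theorem graphHom_X_inr_castSucc (i : Fin d) :
    graphHom f (X (Sum.inr (Fin.castSucc i))) = Polynomial.C (X (Sum.inr i)) := by
  simp [graphHom]

/-- `graphHom` on `x_last`. [folklore] -/
@[simp] theorem graphHom_X_inl_last :
    graphHom f (X (Sum.inl (Fin.last d))) = Polynomial.C (rename Sum.inl f) := by
  simp [graphHom]

/-- `graphHom` on `y_last`. [folklore] -/
@[simp] theorem graphHom_X_inr_last :
    graphHom f (X (Sum.inr (Fin.last d))) = Polynomial.X := by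
  simp [graphHom]

/-- On polynomials in the small variables the substitution is the inclusion of constants. [folklore] -/
theorem graphHom_rename (g : MvPolynomial (Fin d ⊕ Fin d) K) :
    graphHom f (rename (Sum.map (Fin.castSucc (n := d)) (Fin.castSucc (n := d))) g) =
      Polynomial.C g := by
  induction g using MvPolynomial.induction_on with
  | C a =>
    rw [rename_C]
    change graphHom f (algebraMap K _ a) = _
    rw [AlgHom.commutes, Polynomial.algebraMap_apply, MvPolynomial.algebraMap_eq]
  | add p q hp hq => rw [map_add, map_add, hp, hq, Polynomial.C_add]
  | mul_X p t hp =>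
    rw [map_mul, map_mul, hp, rename_X, Polynomial.C_mul]
    rcases t with i | i
    · rw [Sum.map_inl, graphHom_X_inl_castSucc]
    · rw [Sum.map_inr, graphHom_X_inr_castSucc]

/-- **Evaluation through the substitution**: `p(graphPt f s t) = (graphHom f p)^{s}(t)`. [folklore] -/
theorem eval_graphPt (s : Fin d ⊕ Fin d → K) (t : K)
    (p : MvPolynomial (Fin (d + 1) ⊕ Fin (d + 1)) K) :
    MvPolynomial.eval (graphPt f s t) p = ((graphHom f p).map (MvPolynomial.eval s)).eval t := by
  induction p using MvPolynomial.induction_on with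
  | C a =>
    rw [eval_C]
    change a = ((graphHom f (algebraMap K _ a)).map _).eval t
    rw [AlgHom.commutes, Polynomial.algebraMap_apply, MvPolynomial.algebraMap_eq, Polynomial.map_C,
      eval_C, Polynomial.eval_C]
  | add p q hp hq => rw [map_add, map_add, Polynomial.map_add, Polynomial.eval_add, hp, hq]
  | mul_X p j hp =>
    rw [map_mul, eval_X, map_mul, Polynomial.map_mul, Polynomial.eval_mul, hp]
    congr 1
    rcases j with j | j
    · rcases Fin.eq_castSucc_or_eq_last j with ⟨i, rfl⟩ | rfl
      · rw [graphPt_inl_castSucc, graphHom_X_inl_castSucc, Polynomial.map_C, Polynomial.eval_C, eval_X]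
      · rw [graphPt_inl_last, graphHom_X_inl_last, Polynomial.map_C, Polynomial.eval_C, eval_rename]
        rfl
    · rcases Fin.eq_castSucc_or_eq_last j with ⟨i, rfl⟩ | rfl
      · rw [graphPt_inr_castSucc, graphHom_X_inr_castSucc, Polynomial.map_C, Polynomial.eval_C, eval_X]
      · rw [graphPt_inr_last, graphHom_X_inr_last, Polynomial.map_X, Polynomial.eval_X]

/-! ## The vanishing ideal of the graph lift -/

variable [Infinite K]

/-- **`I(W^f(S))` coefficientwise**: `p` vanishes on `W^f(S)` iff every `T`-coefficient of
`graphHom f p ∈ K[x,y][T]` vanishes on `S`. [folklore] -/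
theorem mem_vanishingIdeal_graphVar_iff (S : Set (Fin d ⊕ Fin d → K))
    (p : MvPolynomial (Fin (d + 1) ⊕ Fin (d + 1)) K) :
    p ∈ vanishingIdeal K (graphVar f S) ↔ ∀ k, (graphHom f p).coeff k ∈ vanishingIdeal K S := by
  constructor
  · intro hp k
    rw [mem_vanishingIdeal_iff]
    intro s hs
    have hq : (graphHom f p).map (MvPolynomial.eval s) = 0 := by
      refine Polynomial.funext fun t => ?_
      rw [Polynomial.eval_zero, ← eval_graphPt]
      exact (mem_vanishingIdeal_iff.1 hp) _ ((graphPt_mem_graphVar_iff f s t).2 hs)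
    have := congrArg (fun q => q.coeff k) hq
    simp only [Polynomial.coeff_map, Polynomial.coeff_zero] at this
    exact this
  · intro h
    rw [mem_vanishingIdeal_iff]
    intro w hw
    obtain ⟨s, hs, t, rfl⟩ := (mem_graphVar_iff f).1 hw
    change MvPolynomial.eval (graphPt f s t) p = 0
    rw [eval_graphPt]
    have hq : (graphHom f p).map (MvPolynomial.eval s) = 0 := by
      ext k
      rw [Polynomial.coeff_map, Polynomial.coeff_zero]
      exact (mem_vanishingIdeal_iff.1 (h k)) s hs
    rw [hq, Polynomial.eval_zero]

/-- **`I(W^f(S)) = graphHom⁻¹ (I(S) · K[x,y][T])`.** [folklore] -/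
theorem vanishingIdeal_graphVar (S : Set (Fin d ⊕ Fin d → K)) :
    vanishingIdeal K (graphVar f S) =
      (Ideal.map (Polynomial.C : MvPolynomial (Fin d ⊕ Fin d) K →+* _) (vanishingIdeal K S)).comap
        (graphHom f) := by
  ext p
  rw [mem_vanishingIdeal_graphVar_iff, Ideal.mem_comap, Ideal.mem_map_C_iff]

/-- Polynomials in the small variables vanishing on `S` vanish on the graph lift. [folklore] -/
theorem rename_mem_vanishingIdeal_graphVar {S : Set (Fin d ⊕ Fin d → K)}
    {g : MvPolynomial (Fin d ⊕ Fin d) K} (hg : g ∈ vanishingIdeal K S) :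
    rename (Sum.map (Fin.castSucc (n := d)) (Fin.castSucc (n := d))) g ∈
      vanishingIdeal K (graphVar f S) := by
  rw [mem_vanishingIdeal_graphVar_iff]
  intro k
  rw [graphHom_rename, Polynomial.coeff_C]
  by_cases hk : k = 0
  · rw [if_pos hk]; exact hg
  · rw [if_neg hk]; exact Ideal.zero_mem _

/-- The defining equation `x_last - f(x)` vanishes on the graph lift. [folklore] -/
theorem equation_mem_vanishingIdeal_graphVar (S : Set (Fin d ⊕ Fin d → K)) :
    (X (Sum.inl (Fin.last d)) - rename (Sum.inl ∘ Fin.castSucc) f :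
      MvPolynomial (Fin (d + 1) ⊕ Fin (d + 1)) K) ∈ vanishingIdeal K (graphVar f S) := by
  rw [mem_vanishingIdeal_graphVar_iff]
  intro k
  have hren : rename (Sum.inl ∘ Fin.castSucc) f =
      rename (Sum.map (Fin.castSucc (n := d)) (Fin.castSucc (n := d)))
        (rename Sum.inl f : MvPolynomial (Fin d ⊕ Fin d) K) := by
    rw [rename_rename]
    rfl
  rw [map_sub, graphHom_X_inl_last, hren, graphHom_rename, sub_self, Polynomial.coeff_zero]
  exact Ideal.zero_mem _

/-- **The graph lift of a Zariski closed set is Zariski closed.** [folklore] -/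
theorem isZariskiClosed_graphVar {S : Set (Fin d ⊕ Fin d → K)} (hS : IsZariskiClosed K S) :
    IsZariskiClosed K (graphVar f S) := by
  refine ⟨vanishingIdeal K (graphVar f S), le_antisymm (zeroLocus_vanishingIdeal_le _) ?_⟩
  intro w hw
  rw [mem_zeroLocus_iff] at hw
  have hS' : S = zeroLocus K (vanishingIdeal K S) := eq_zeroLocus_vanishingIdeal_of_isZariskiClosed hS
  refine ⟨?_, ?_⟩
  · rw [hS', mem_zeroLocus_iff]
    intro g hg
    have := hw _ (rename_mem_vanishingIdeal_graphVar f hg)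
    rwa [aeval_rename] at this
  · have := hw _ (equation_mem_vanishingIdeal_graphVar f S)
    rw [map_sub, aeval_X, aeval_rename, sub_eq_zero] at this
    rw [this]
    rfl

/-! ## The coordinate ring of the graph lift is `K[S][T]` -/

/-- The substitution followed by reduction of coefficients modulo `I(S)`. [folklore] -/
def graphQuot (S : Set (Fin d ⊕ Fin d → K)) :
    MvPolynomial (Fin (d + 1) ⊕ Fin (d + 1)) K →+*
      Polynomial (MvPolynomial (Fin d ⊕ Fin d) K ⧸ vanishingIdeal K S) :=
  (Polynomial.mapRingHom (Ideal.Quotient.mk (vanishingIdeal K S))).comp (graphHom f).toRingHom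

omit [Infinite K] in
/-- `graphHom f` is onto `K[x,y][T]`. [folklore] -/
theorem graphHom_surjective : Function.Surjective (graphHom (K := K) f) := by
  intro q
  refine ⟨∑ k ∈ q.support, rename (Sum.map (Fin.castSucc (n := d)) (Fin.castSucc (n := d)))
    (q.coeff k) * X (Sum.inr (Fin.last d)) ^ k, ?_⟩
  rw [map_sum]
  conv_rhs => rw [← Polynomial.sum_C_mul_X_pow_eq q]
  refine Finset.sum_congr rfl fun k _ => ?_
  rw [map_mul, map_pow, graphHom_rename, graphHom_X_inr_last]

omit [Infinite K] in
/-- `graphQuot f S` is onto `K[S][T]`. [folklore] -/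
theorem graphQuot_surjective (S : Set (Fin d ⊕ Fin d → K)) : Function.Surjective (graphQuot f S) :=
  (Polynomial.map_surjective _ Ideal.Quotient.mk_surjective).comp (graphHom_surjective f)

/-- **`I(W^f(S)) = ker (K[x, x_last, y, y_last] → K[S][T])`.** [folklore] -/
theorem vanishingIdeal_graphVar_eq_ker (S : Set (Fin d ⊕ Fin d → K)) :
    vanishingIdeal K (graphVar f S) = RingHom.ker (graphQuot f S) := by
  rw [graphQuot, ← RingHom.comap_ker, Polynomial.ker_mapRingHom, Ideal.mk_ker, vanishingIdeal_graphVar]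
  rfl

/-- **The coordinate ring of `W^f(S)` is `K[S][T]`.** [folklore] -/
def coordRingGraphVarEquiv (S : Set (Fin d ⊕ Fin d → K)) :
    (MvPolynomial (Fin (d + 1) ⊕ Fin (d + 1)) K ⧸ vanishingIdeal K (graphVar f S)) ≃+*
      Polynomial (MvPolynomial (Fin d ⊕ Fin d) K ⧸ vanishingIdeal K S) :=
  (Ideal.quotEquivOfEq (vanishingIdeal_graphVar_eq_ker f S)).trans
    (RingHom.quotientKerEquivOfSurjective (graphQuot_surjective f S))

/-- **The graph lift of an irreducible closed set is irreducible closed.** [folklore] -/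
theorem isIrreducibleClosed_graphVar {S : Set (Fin d ⊕ Fin d → K)} (hS : IsIrreducibleClosed K S) :
    IsIrreducibleClosed K (graphVar f S) := by
  refine ⟨isZariskiClosed_graphVar f hS.1, ?_⟩
  haveI := hS.2
  rw [vanishingIdeal_graphVar_eq_ker]
  exact RingHom.ker_isPrime _

/-- **`dim W^f(S) = dim S + 1`.** [folklore] -/
theorem zariskiDim_graphVar (S : Set (Fin d ⊕ Fin d → K)) :
    zariskiDim K (graphVar f S) = zariskiDim K S + 1 := by
  unfold zariskiDim
  rw [ringKrullDim_eq_of_ringEquiv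
      (S := Polynomial (MvPolynomial (Fin d ⊕ Fin d) K ⧸ vanishingIdeal K S))
      (coordRingGraphVarEquiv f S),
    Polynomial.ringKrullDim_of_isNoetherianRing]

end Summit.Schanuel.Schanuel.Theorems
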